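import Summits.QuantumAdvantage.QuantumAdvantage.Theorems.CubicForrelationNearExactIsExactWalshTower
import Summits.QuantumAdvantage.QuantumAdvantage.Theorems.CubicForrelationNearExactIsExactAxParity
import Summits.QuantumAdvantage.QuantumAdvantage.Theorems.CubicForrelationNearExactIsExactMmNormalForm

/-!
# Crux `CubicForrelation.NearExactIsExact` (stmt-QuantumAdvantage-14043), line `direct-sum-amplification`, lead c6 cycle 2 (wave 3):
  stub `stub_basisWithTwo` — an invertible matrix over 𝔽₂ with two prescribed last columns

Two distinct non-zero vectors `e, c ∈ 𝔽₂^{n+2}` are linearly independent (over `ZMod 2` the only scalars are `0, 1`), hence can be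
completed to a basis; the matrix `N` whose columns are that basis with `e, c` in the last two positions is invertible and maps the last two
standard basis vectors to `e` and `c`.  Used by the lead (with the landed `stub_linearTransport`) to put the complementing structure `e` of
`δ` and the split covector `c` on the coordinates `y₉, y₁₀`.
-/

set_option linter.dupNamespace false -- D-0017: single-problem summit ⇒ `QuantumAdvantage.QuantumAdvantage` by design

noncomputable section

namespace Summit.QuantumAdvantage.QuantumAdvantage.Theorems.CubicForrelation.NearExactIsExact

open Finset
open Literature.Computability.QuantumComplexity
open Literature.Computability.QuantumComplexity.BuzetChailloux (bxor zeroVec signOf_sq)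
open Literature.Computability.QuantumComplexity.DerivativeWalsh (W)
open scoped Matrix

/-- **An invertible matrix over `𝔽₂` with two prescribed last columns.**  If `e, c ∈ 𝔽₂^{n+2}` are non-zero and
distinct then `N e_n = e`, `N e_{n+1} = c` for some `N` with a left inverse `N'`. [linear algebra: basis extension] -/
theorem stub_basisWithTwo :
    ∀ (n : ℕ) (e c : Fin (n + 2) → ZMod 2), e ≠ 0 → c ≠ 0 → e ≠ c →
      ∃ N N' : Matrix (Fin (n + 2)) (Fin (n + 2)) (ZMod 2), N' * N = 1 ∧
        N *ᵥ Pi.single ⟨n, by omega⟩ 1 = e ∧ N *ᵥ Pi.single ⟨n + 1, by omega⟩ 1 = c := by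
  intro n e c he hc hec
  -- (1) `{e, c}` is linearly independent: the only scalars of `ZMod 2` are `0` and `1`.
  have hli : LinearIndepOn (ZMod 2) id ({e, c} : Set (Fin (n + 2) → ZMod 2)) := by
    refine linearIndepOn_id_pair he fun a => ?_
    rcases (show ∀ a : ZMod 2, a = 0 ∨ a = 1 by decide) a with rfl | rfl
    · simpa using hc.symm
    · simpa using hec
  classical
  -- (2) extend it to a basis `b` of `𝔽₂^{n+2}` indexed by a set `T ∋ e, c` of cardinality `n + 2`.
  obtain ⟨T, heT, hcT, b, hb⟩ : ∃ T : Set (Fin (n + 2) → ZMod 2), e ∈ T ∧ c ∈ T ∧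
      ∃ b : Module.Basis T (ZMod 2) (Fin (n + 2) → ZMod 2), ∀ x, b x = x :=
    ⟨hli.extend (Set.subset_univ _), hli.subset_extend _ (by simp), hli.subset_extend _ (by simp),
      Module.Basis.extend hli, Module.Basis.extend_apply_self hli⟩
  have hcard : Nat.card T = n + 2 := by
    rw [← Module.finrank_eq_nat_card_basis b, Module.finrank_fin_fun]
  -- (3) reindex by `Fin (n + 2)` so that `e ↦ n` and `c ↦ n + 1` (two `Equiv.setValue` corrections).
  obtain ⟨σ, hσe, hσc⟩ :
      ∃ σ : T ≃ Fin (n + 2), σ ⟨e, heT⟩ = ⟨n, by omega⟩ ∧ σ ⟨c, hcT⟩ = ⟨n + 1, by omega⟩ := by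
    obtain ⟨σ₁, h₁⟩ : ∃ σ₁ : T ≃ Fin (n + 2), σ₁ ⟨e, heT⟩ = ⟨n, by omega⟩ :=
      ⟨(Finite.equivFinOfCardEq hcard).setValue ⟨e, heT⟩ ⟨n, by omega⟩, Equiv.setValue_eq _ _ _⟩
    refine ⟨σ₁.setValue ⟨c, hcT⟩ ⟨n + 1, by omega⟩, ?_, Equiv.setValue_eq _ _ _⟩
    have hne₁ : (⟨e, heT⟩ : T) ≠ ⟨c, hcT⟩ := fun h => hec (congrArg Subtype.val h)
    have hne₂ : (⟨e, heT⟩ : T) ≠ σ₁.symm ⟨n + 1, by omega⟩ := by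
      intro h
      have h' := congrArg (fun x => (σ₁ x : ℕ)) h
      simp only [h₁, Equiv.apply_symm_apply] at h'
      omega
    show σ₁ (Equiv.swap (⟨c, hcT⟩ : T) (σ₁.symm ⟨n + 1, by omega⟩) ⟨e, heT⟩) = ⟨n, by omega⟩
    rw [Equiv.swap_apply_of_ne_of_ne hne₁ hne₂, h₁]
  obtain ⟨v, hvn, hvn1⟩ : ∃ v : Module.Basis (Fin (n + 2)) (ZMod 2) (Fin (n + 2) → ZMod 2),
      v ⟨n, by omega⟩ = e ∧ v ⟨n + 1, by omega⟩ = c := by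
    refine ⟨b.reindex σ, ?_, ?_⟩
    · rw [Module.Basis.reindex_apply, ← hσe, Equiv.symm_apply_apply, hb]
    · rw [Module.Basis.reindex_apply, ← hσc, Equiv.symm_apply_apply, hb]
  -- (4) `N` := the matrix of `v` in the standard basis (columns `v j`), `N'` := its inverse.
  refine ⟨(Pi.basisFun (ZMod 2) (Fin (n + 2))).toMatrix v, v.toMatrix (Pi.basisFun (ZMod 2) _),
    Module.Basis.toMatrix_mul_toMatrix_flip _ _, ?_, ?_⟩
  · rw [Matrix.mulVec_single_one, Matrix.col_apply']
    funext i
    rw [Module.Basis.toMatrix_apply, Pi.basisFun_repr, hvn]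
  · rw [Matrix.mulVec_single_one, Matrix.col_apply']
    funext i
    rw [Module.Basis.toMatrix_apply, Pi.basisFun_repr, hvn1]

end Summit.QuantumAdvantage.QuantumAdvantage.Theorems.CubicForrelation.NearExactIsExact
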